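import Literature.NumberTheory.EllipticCurves.UnramifiedLayerTwistedKummerProofs
import Literature.NumberTheory.EllipticCurves.LocalFrobeniusGenerationProofs
import Literature.NumberTheory.EllipticCurves.ZpExtension
import Literature.NumberTheory.EllipticCurves.Sha
import Mathlib.RingTheory.Polynomial.Cyclotomic.Eval
import Mathlib.RingTheory.Polynomial.Cyclotomic.Roots
import HarnessLib

/-!
# The cyclotomic tower is totally ramified at `p`: a Frobenius of `K_v` fixing `μ_{p^∞}`

`Proofs` file (theorems only: no definition, no named fact) in topic `NumberTheory/EllipticCurves`;
a brick of the elementary proof of Greenberg's Lemma 3.4 at the layer `n = 0`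
(`IwasawaLocalKummerSkeletonProofs`, hypothesis (fin): "`Ẽ(k_∞)` is finite", i.e. the residue
field of `K_{∞,η}` is that of `K_v`). For a finite place `v ∣ p` of a number field `K` at which `p`
is a uniformiser of `𝓞_v` (`v` unramified over `p`; every `p` for `K = ℚ`):

* `exists_mem_inertia_smul_eq_of_isPrimitiveRoot` — **`K_v(μ_{pⁿ})/K_v` is totally ramified**:
  the inertia group `I_𝔐 ≤ Γ_{K_v}` acts transitively on the primitive `pⁿ`-th roots of unity of
  `K̄_v` (Neukirch, *ANT*, II (7.13)(i); Serre, *Local Fields*, IV §4 Prop. 17). Proof by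
  valuations, without irreducibility of cyclotomic polynomials: `∏_{μ primitive} (1 - μ) = p` and
  all `|1 - μ|_v` are equal, so `|1 - μ|_v^{φ(pⁿ)} = |p|_v`; if the inertia orbit `O` of `ζ` had
  `d < φ(pⁿ)` elements, `∏_{η ∈ O} (1 - η)` would be an element of the inertia field `K_v^nr` of
  valuation `|p|_v^{d/φ(pⁿ)} ∉ |p|_v^ℤ`, contradicting the discreteness of `K_v^nr` with
  uniformiser `p` (`spectralValuation_le_of_forall_inertia`).
* `exists_isArithFrobAt_forall_smul_eq` — hence (Cantor's intersection theorem in the compact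
  `I_𝔐`, along a compatible system `ζ_{p^{n+1}}^p = ζ_{pⁿ}`) there is an arithmetic Frobenius
  `τ ∈ Γ_{K_v}` at `𝔐` fixing every `p`-power root of unity of `K̄_v`;
* `ZpExtension.IsCyclotomic.exists_isArithFrobAt_resGal_mem_kerSubgroup` — for the cyclotomic
  `ℤ_p`-extension `κ` of `K` (`ker κ = χ_p⁻¹(μ(ℤ_p))`), such a `τ` has `resGal τ ∈ ker κ`: the local
  subgroup `H_{v,∞} = (Γ_{K_v} → Γ_K)⁻¹(Gal(K̄/K_∞))` contains a Frobenius, i.e. the residue field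
  of `K_{∞,η}` is `k_v` ("`ℚ_∞/ℚ` is totally ramified at `p`", Washington, *Cyclotomic Fields*,
  §13.1; Greenberg, LNM 1716, §3 p. 89: "`v_n` is totally ramified in `F_∞/F_n`").

## References

* [NeukirchANT1999] J. Neukirch, *Algebraic Number Theory* (1999), Ch. II (7.13)(i), §9.
* [SerreLocalFields1979] J.-P. Serre, *Local Fields* (1979), IV §4 Prop. 17.
* [Washington1997] L. C. Washington, *Introduction to Cyclotomic Fields*, 2nd ed., §13.1.
* [GreenbergLNM1716] R. Greenberg, *Iwasawa theory for elliptic curves*, LNM 1716 (1999), §3,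
  p. 89.
-/

noncomputable section

open scoped Classical NNReal Pointwise
open NumberField IsDedekindDomain

universe u

namespace IsDedekindDomain.HeightOneSpectrum

open Literature.NumberTheory.EllipticCurves Literature.NumberTheory.GaloisRepresentations Field
  Literature.NumberTheory.EllipticCurves.TwistedKummer
  Literature.NumberTheory.GaloisRepresentations.IsNonarchimedeanLocalField

variable {K : Type u} [Field K] [NumberField K] {v : HeightOneSpectrum (𝓞 K)}
  {w : Valuation (AlgebraicClosure (v.adicCompletion K)) ℝ≥0}
  (hw : ∀ x, (w x : ℝ) = spectralNorm (v.adicCompletion K) (AlgebraicClosure (v.adicCompletion K)) x)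

/-! ## §1 Valuations of `1 - μ` for `p`-power roots of unity -/

/-- `|1 - μ^b| ≤ |1 - μ|` for `|μ| ≤ 1` (`1 - μ^b = (1 - μ)(1 + μ + ⋯ + μ^{b-1})`). [folklore] -/
theorem val_one_sub_pow_le {μ : AlgebraicClosure (v.adicCompletion K)} (hμ : w μ ≤ 1) (b : ℕ) :
    w (1 - μ ^ b) ≤ w (1 - μ) := by
  have e : 1 - μ ^ b = (1 - μ) * ∑ i ∈ Finset.range b, μ ^ i := by
    rw [mul_comm, ← neg_sub (μ ^ b), ← neg_sub μ, mul_neg, geom_sum_mul]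
  rw [e, map_mul]
  refine mul_le_of_le_one_right' (Valuation.map_sum_le w fun i _ ↦ ?_)
  rw [map_pow]; exact pow_le_one₀ zero_le hμ

/-- Primitive roots of unity of the same order `N` have the same `|1 - μ|`. [folklore] -/
theorem val_one_sub_eq_of_isPrimitiveRoot {N : ℕ} {μ μ' : AlgebraicClosure (v.adicCompletion K)}
    (hμ : IsPrimitiveRoot μ N) (hμ' : IsPrimitiveRoot μ' N) (hN : N ≠ 0) :
    w (1 - μ) = w (1 - μ') := by
  haveI : NeZero N := ⟨hN⟩
  have h1 : w μ ≤ 1 := (val_eq_one_of_pow_eq_one w hN hμ.pow_eq_one).le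
  have h1' : w μ' ≤ 1 := (val_eq_one_of_pow_eq_one w hN hμ'.pow_eq_one).le
  obtain ⟨b, -, rfl⟩ := hμ.eq_pow_of_pow_eq_one hμ'.pow_eq_one
  refine le_antisymm ?_ (val_one_sub_pow_le h1 b)
  obtain ⟨b', -, hb'⟩ := hμ'.eq_pow_of_pow_eq_one hμ.pow_eq_one
  conv_lhs => rw [← hb']
  exact val_one_sub_pow_le h1' b'

/-- **`∏_{μ primitive pⁿ-th root} (1 - μ) = p`** (`Φ_{pⁿ}(1) = p`, Mathlib
`Polynomial.eval_one_cyclotomic_prime_pow` and `cyclotomic_eq_prod_X_sub_primitiveRoots`).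
[folklore] -/
theorem prod_one_sub_primitiveRoots {p : ℕ} [hp : Fact p.Prime] (n : ℕ)
    {ζ : AlgebraicClosure (v.adicCompletion K)} (hζ : IsPrimitiveRoot ζ (p ^ (n + 1))) :
    ∏ μ ∈ primitiveRoots (p ^ (n + 1)) (AlgebraicClosure (v.adicCompletion K)), (1 - μ) = p := by
  have h := Polynomial.eval_one_cyclotomic_prime_pow (R := AlgebraicClosure (v.adicCompletion K))
    (p := p) n
  rw [Polynomial.cyclotomic_eq_prod_X_sub_primitiveRoots hζ, Polynomial.eval_prod] at h
  simpa only [Polynomial.eval_sub, Polynomial.eval_X, Polynomial.eval_C] using h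

/-- **`|1 - ζ|^{φ(pⁿ)} = |p|`** for a primitive `pⁿ`-th root of unity `ζ`, `n ≥ 1`. [folklore] -/
theorem val_one_sub_pow_totient_eq {p : ℕ} [hp : Fact p.Prime] (n : ℕ)
    {ζ : AlgebraicClosure (v.adicCompletion K)} (hζ : IsPrimitiveRoot ζ (p ^ (n + 1))) :
    w (1 - ζ) ^ Nat.totient (p ^ (n + 1)) = w (p : AlgebraicClosure (v.adicCompletion K)) := by
  have hN : p ^ (n + 1) ≠ 0 := pow_ne_zero _ hp.out.ne_zero
  rw [← prod_one_sub_primitiveRoots n hζ, map_prod, ← hζ.card_primitiveRoots, ← Finset.prod_const]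
  refine Finset.prod_congr rfl fun μ hμ ↦ ?_
  rw [mem_primitiveRoots (pow_pos hp.out.pos _)] at hμ
  exact val_one_sub_eq_of_isPrimitiveRoot hζ hμ hN

/-! ## §2 The inertia group acts transitively on the primitive `pⁿ`-th roots of unity -/

variable {𝔐 : Ideal v.localAbsIntegers} (h𝔐 : 𝔐 ∈ v.localPrimesAbove)
  {p : ℕ} [hp : Fact p.Prime] (hpv : (p : 𝓞 K) ∈ v.asIdeal)
  (hϖ : Irreducible ((p : ℕ) : v.adicCompletionIntegers K))

/-- A Galois conjugate of a primitive root of unity is a primitive root of unity of the same order.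
[folklore] -/
theorem isPrimitiveRoot_smul {N : ℕ} {ζ : AlgebraicClosure (v.adicCompletion K)}
    (hζ : IsPrimitiveRoot ζ N) (σ : absoluteGaloisGroup (v.adicCompletion K)) :
    IsPrimitiveRoot (σ • ζ) N := by
  have hf : Function.Injective (MulSemiringAction.toRingHom (absoluteGaloisGroup (v.adicCompletion K))
      (AlgebraicClosure (v.adicCompletion K)) σ) := RingHom.injective _
  exact hζ.map_of_injective hf

include hw hpv in
/-- `0 < |p|_v < 1` at a place `v ∣ p`. [folklore] -/
theorem spectralValuation_natCast_prime_lt_one_and_pos :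
    w (p : AlgebraicClosure (v.adicCompletion K)) < 1 ∧
      0 < w (p : AlgebraicClosure (v.adicCompletion K)) := by
  haveI : CharZero (v.adicCompletion K) :=
    charZero_of_injective_algebraMap (algebraMap K (v.adicCompletion K)).injective
  haveI : CharZero (AlgebraicClosure (v.adicCompletion K)) := charZero_of_injective_algebraMap
    (algebraMap (v.adicCompletion K) (AlgebraicClosure (v.adicCompletion K))).injective
  refine ⟨?_, (Valuation.pos_iff w).mpr (Nat.cast_ne_zero.mpr hp.out.ne_zero)⟩
  have := spectralValuation_algebraMap_ringOfIntegers_lt_one hw hpv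
  rwa [map_natCast] at this

include hw h𝔐 hpv hϖ in
/-- **The values of the inertia field `K_v^nr` lie in `|p|^ℤ`** when `p` is a uniformiser of
`𝓞_v` (the value group of the maximal unramified extension is that of `K_v`; Neukirch, *ANT*, II
(7.5) and (9.11); `spectralValuation_le_of_forall_inertia` and the layer lemma
`TwistedKummer.exists_val_eq_zpow`; the tree's
`exists_spectralValuation_eq_zpow_of_forall_inertia` of `UnramifiedThreeTorsionGoodReduction` is the
same statement for an arbitrary uniformiser `ϖ`, in a heavier module). [cite: NeukirchANT1999, Ch. II (7.5)] -/
theorem exists_spectralValuation_eq_zpow_prime_of_forall_inertia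
    {x : AlgebraicClosure (v.adicCompletion K)}
    (hx : ∀ σ ∈ 𝔐.inertia (absoluteGaloisGroup (v.adicCompletion K)), σ • x = x) (hx0 : x ≠ 0) :
    ∃ m : ℤ, w x = w (p : AlgebraicClosure (v.adicCompletion K)) ^ m := by
  obtain ⟨hp1, hp0⟩ := spectralValuation_natCast_prime_lt_one_and_pos hw hpv
  -- the inertia field as a subfield
  let L : Subfield (AlgebraicClosure (v.adicCompletion K)) :=
    (maxUnramified (v.adicCompletion K)).toSubfield
  have hLmem : ∀ y, y ∈ L ↔ ∀ σ ∈ 𝔐.inertia (absoluteGaloisGroup (v.adicCompletion K)), σ • y = y :=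
    fun y ↦ by
      change y ∈ maxUnramified (v.adicCompletion K) ↔ _
      rw [mem_maxUnramified_iff_forall_inertia hw h𝔐]
      rfl
  have hdisc : ∀ y ∈ L, w y < 1 → w y ≤ w (p : AlgebraicClosure (v.adicCompletion K)) := by
    intro y hy hy1
    have h := spectralValuation_le_of_forall_inertia hw h𝔐 hϖ ((hLmem y).mp hy) hy1
    have e1 : algebraMap (v.adicCompletion K) (AlgebraicClosure (v.adicCompletion K))
        ((p : v.adicCompletionIntegers K) : v.adicCompletion K) =
        (p : AlgebraicClosure (v.adicCompletion K)) := by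
      rw [SubringClass.coe_natCast, map_natCast]
    rwa [e1] at h
  exact exists_val_eq_zpow w L p hp1 hp0 hdisc ((hLmem x).mpr hx) hx0

include hw h𝔐 hpv hϖ in
/-- **`K_v(μ_{pⁿ})/K_v` is totally ramified: the inertia group acts transitively on the primitive
`pⁿ`-th roots of unity** (`p` a uniformiser of `𝓞_v`, `n ≥ 1`). Proof: the inertia orbit `O` of
`ζ` is stable under `I_𝔐`, so `g = ∏_{η ∈ O} (1 - η)` lies in the inertia field and
`|g| ∈ |p|^ℤ`; but `|1 - η| = |1 - ζ|` on `O` and `|1 - ζ|^{φ(pⁿ)} = |p|`, so `|g| = |p|^{#O/φ(pⁿ)}`,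
forcing `#O = φ(pⁿ)`. Neukirch, *ANT*, II (7.13)(i); Serre, *Local Fields*, IV §4 Prop. 17.
[cite: NeukirchANT1999, Ch. II (7.13)(i)] [cite: SerreLocalFields1979, Ch. IV §4 Prop. 17] -/
theorem exists_mem_inertia_smul_eq_of_isPrimitiveRoot (n : ℕ)
    {ζ μ : AlgebraicClosure (v.adicCompletion K)} (hζ : IsPrimitiveRoot ζ (p ^ (n + 1)))
    (hμ : IsPrimitiveRoot μ (p ^ (n + 1))) :
    ∃ ι ∈ 𝔐.inertia (absoluteGaloisGroup (v.adicCompletion K)), ι • ζ = μ := by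
  obtain ⟨hp1, hp0⟩ := spectralValuation_natCast_prime_lt_one_and_pos hw hpv
  set N : ℕ := p ^ (n + 1) with hNdef
  have hN0 : 0 < N := pow_pos hp.out.pos _
  have hN1 : 1 < N := Nat.one_lt_pow (by omega) hp.out.one_lt
  set I : Subgroup (absoluteGaloisGroup (v.adicCompletion K)) :=
    𝔐.inertia (absoluteGaloisGroup (v.adicCompletion K)) with hIdef
  -- the inertia orbit of `ζ`
  let O : Finset (AlgebraicClosure (v.adicCompletion K)) :=
    (primitiveRoots N (AlgebraicClosure (v.adicCompletion K))).filter fun η ↦ ∃ ι ∈ I, ι • ζ = η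
  have hOmem : ∀ η, η ∈ O ↔ IsPrimitiveRoot η N ∧ ∃ ι ∈ I, ι • ζ = η := fun η ↦ by
    rw [Finset.mem_filter, mem_primitiveRoots hN0]
  have hOsub : O ⊆ primitiveRoots N (AlgebraicClosure (v.adicCompletion K)) := Finset.filter_subset _ _
  have hζO : ζ ∈ O := (hOmem ζ).mpr ⟨hζ, 1, I.one_mem, one_smul _ _⟩
  -- `O` is stable under every `σ ∈ I`
  have hstab : ∀ σ ∈ I, O.image (fun η ↦ σ • η) = O := by
    intro σ hσ
    apply Finset.eq_of_subset_of_card_le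
    · intro η hη
      obtain ⟨η', hη', rfl⟩ := Finset.mem_image.mp hη
      obtain ⟨hη'prim, ι, hι, rfl⟩ := (hOmem η').mp hη'
      exact (hOmem _).mpr ⟨isPrimitiveRoot_smul hη'prim σ, σ * ι, I.mul_mem hσ hι, mul_smul σ ι ζ⟩
    · rw [Finset.card_image_of_injective _ (MulAction.injective σ)]
  -- `g = ∏_{η ∈ O} (1 - η)` is fixed by `I` and non-zero
  set g : AlgebraicClosure (v.adicCompletion K) := ∏ η ∈ O, (1 - η) with hgdef
  have hgfix : ∀ σ ∈ I, σ • g = g := by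
    intro σ hσ
    rw [hgdef, ← MulSemiringAction.toRingHom_apply _ _ σ, map_prod]
    simp only [map_sub, map_one, MulSemiringAction.toRingHom_apply]
    rw [← Finset.prod_image (s := O) (g := fun η ↦ σ • η) (f := fun η ↦ 1 - η)
      (fun a _ b _ h ↦ MulAction.injective σ h), hstab σ hσ]
  have hg0 : g ≠ 0 := by
    rw [hgdef, Finset.prod_ne_zero_iff]
    intro η hη h0
    have hη1 : η = 1 := (sub_eq_zero.mp h0).symm
    have hprim := ((hOmem η).mp hη).1
    rw [hη1] at hprim
    exact absurd (hprim.eq_orderOf.trans orderOf_one) hN1.ne'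
  -- valuations: `|g| = |1 - ζ|^d`, `|1 - ζ|^φ = |p|`, `|g| = |p|^m`
  set d : ℕ := O.card with hddef
  set φ : ℕ := Nat.totient N with hφdef
  have hval_g : w g = w (1 - ζ) ^ d := by
    rw [hgdef, map_prod, ← Finset.prod_const]
    refine Finset.prod_congr rfl fun η hη ↦ ?_
    exact val_one_sub_eq_of_isPrimitiveRoot ((hOmem η).mp hη).1 hζ hN0.ne'
  have hval_ζ : w (1 - ζ) ^ φ = w (p : AlgebraicClosure (v.adicCompletion K)) :=
    val_one_sub_pow_totient_eq n hζ
  obtain ⟨m, hm⟩ := exists_spectralValuation_eq_zpow_prime_of_forall_inertia hw h𝔐 hpv hϖ hgfix hg0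
  -- `d = m φ`
  have hdφ : (d : ℤ) = m * φ := by
    apply zpow_right_injective₀ hp0 hp1.ne
    dsimp only
    rw [zpow_natCast, zpow_mul, zpow_natCast, ← hm, hval_g, ← pow_mul, mul_comm, pow_mul, hval_ζ]
  -- hence `d = φ` (`0 < d ≤ φ`)
  have hdpos : 0 < d := Finset.card_pos.mpr ⟨ζ, hζO⟩
  have hdle : d ≤ φ := by
    rw [hφdef, ← hζ.card_primitiveRoots]; exact Finset.card_le_card hOsub
  have hφpos : 0 < φ := Nat.totient_pos.mpr hN0
  have hdeq : d = φ := by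
    have hm1 : 1 ≤ m := by
      by_contra hlt
      have hlt' : m ≤ 0 := by omega
      have : (d : ℤ) ≤ 0 := by
        rw [hdφ]; exact mul_nonpos_of_nonpos_of_nonneg hlt' (by exact_mod_cast hφpos.le)
      omega
    have : (φ : ℤ) ≤ d := by
      rw [hdφ]; nlinarith
    exact le_antisymm hdle (by exact_mod_cast this)
  -- so `O` is all the primitive roots and `μ ∈ O`
  have hOeq : O = primitiveRoots N (AlgebraicClosure (v.adicCompletion K)) :=
    Finset.eq_of_subset_of_card_le hOsub (by rw [hζ.card_primitiveRoots, ← hφdef, ← hdeq])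
  have hμO : μ ∈ O := by rw [hOeq, mem_primitiveRoots hN0]; exact hμ
  exact ((hOmem μ).mp hμO).2

/-! ## §3 A Frobenius fixing all `p`-power roots of unity -/

/-- **A compatible system of primitive `p^{n+1}`-th roots of unity in `K̄_v`** (`ζ_{n+1}^p = ζ_n`):
take successive `p`-th roots in the algebraically closed field `K̄_v` of characteristic `0`.
[folklore] -/
theorem exists_compatible_primitiveRoots [CharZero (AlgebraicClosure (v.adicCompletion K))] :
    ∃ z : ℕ → AlgebraicClosure (v.adicCompletion K),
      (∀ n, IsPrimitiveRoot (z n) (p ^ (n + 1))) ∧ ∀ n, z (n + 1) ^ p = z n := by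
  have hpp := hp.out
  -- one step: a `p`-th root of a primitive `p^{n+1}`-th root is a primitive `p^{n+2}`-th root
  have hstep : ∀ (n : ℕ) (t : AlgebraicClosure (v.adicCompletion K)),
      IsPrimitiveRoot t (p ^ (n + 1)) →
        ∃ y : AlgebraicClosure (v.adicCompletion K), y ^ p = t ∧ IsPrimitiveRoot y (p ^ (n + 2)) := by
    intro n t ht
    obtain ⟨y, hy⟩ := IsAlgClosed.exists_pow_nat_eq t hpp.pos
    refine ⟨y, hy, ?_⟩
    have hnot : ¬ y ^ p ^ (n + 1) = 1 := by
      rw [pow_succ', pow_mul, hy, ht.pow_eq_one_iff_dvd]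
      intro hdvd
      exact absurd (Nat.le_of_dvd (pow_pos hpp.pos _) hdvd)
        (not_le.mpr (Nat.pow_lt_pow_right hpp.one_lt (by omega)))
    have hfin : y ^ p ^ (n + 1 + 1) = 1 := by
      rw [pow_succ', pow_mul, hy, ht.pow_eq_one]
    have hord := orderOf_eq_prime_pow hnot hfin
    have := IsPrimitiveRoot.orderOf y
    rwa [hord] at this
  -- the base: a primitive `p`-th root
  haveI : NeZero ((p ^ 1 : ℕ) : AlgebraicClosure (v.adicCompletion K)) :=
    ⟨by exact_mod_cast pow_ne_zero 1 hpp.ne_zero⟩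
  obtain ⟨z₀, hz₀⟩ := HasEnoughRootsOfUnity.exists_primitiveRoot (AlgebraicClosure (v.adicCompletion K))
    (p ^ 1)
  choose f hfp hfprim using hstep
  -- the sequence of dependent pairs
  let T : ℕ → Type u := fun n ↦ {t : AlgebraicClosure (v.adicCompletion K) // IsPrimitiveRoot t (p ^ (n + 1))}
  let seq : ∀ n, T n := fun n ↦ Nat.rec (motive := T) ⟨z₀, hz₀⟩
    (fun n tn ↦ ⟨f n tn.1 tn.2, hfprim n tn.1 tn.2⟩) n
  refine ⟨fun n ↦ (seq n).1, fun n ↦ (seq n).2, fun n ↦ ?_⟩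
  exact hfp n (seq n).1 (seq n).2

include hw h𝔐 hpv hϖ in
/-- **An arithmetic Frobenius of `K_v` fixing every `p`-power root of unity** (`p` a uniformiser of
`𝓞_v`): by `exists_mem_inertia_smul_eq_of_isPrimitiveRoot` the inertia group can match any
Frobenius `F₀` on `ζ_{pⁿ}` for each `n`; along a compatible system `ζ_{p^{n+1}}^p = ζ_{pⁿ}` the sets
of `ι ∈ I_𝔐` with `ι ζ_{pⁿ} = F₀ ζ_{pⁿ}` are closed, non-empty and decreasing in the compact group
`Γ_{K_v}`, so some `ι` works for all `n` (Cantor), and `τ = ι⁻¹ F₀` is the required Frobenius.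
This is the local form of "`K_v(μ_{p^∞})/K_v` is totally ramified" (Neukirch, *ANT*, II (7.13);
Serre, *Local Fields*, IV §4). [cite: NeukirchANT1999, Ch. II (7.13)(i)] -/
theorem exists_isArithFrobAt_forall_smul_eq :
    ∃ τ : absoluteGaloisGroup (v.adicCompletion K),
      IsArithFrobAt (v.adicCompletionIntegers K) τ 𝔐 ∧
        ∀ (k : ℕ) (ξ : AlgebraicClosure (v.adicCompletion K)), ξ ^ p ^ k = 1 → τ • ξ = ξ := by
  haveI : CharZero (v.adicCompletion K) :=
    charZero_of_injective_algebraMap (algebraMap K (v.adicCompletion K)).injective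
  haveI : CharZero (AlgebraicClosure (v.adicCompletion K)) := charZero_of_injective_algebraMap
    (algebraMap (v.adicCompletion K) (AlgebraicClosure (v.adicCompletion K))).injective
  have hpp := hp.out
  set G := absoluteGaloisGroup (v.adicCompletion K) with hGdef
  set I : Subgroup G := 𝔐.inertia G with hIdef
  obtain ⟨F₀, hF₀⟩ := exists_isArithFrobAt_localAbsIntegers (v := v) h𝔐
  obtain ⟨z, hz, hzp⟩ : ∃ z : ℕ → AlgebraicClosure (v.adicCompletion K),
      (∀ n, IsPrimitiveRoot (z n) (p ^ (n + 1))) ∧ ∀ n, z (n + 1) ^ p = z n :=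
    exists_compatible_primitiveRoots
  -- the roots as local absolute integers
  have hz1 : ∀ n, w (z n) ≤ 1 := fun n ↦
    (val_eq_one_of_pow_eq_one w (pow_ne_zero _ hpp.ne_zero) (hz n).pow_eq_one).le
  let b : ℕ → localAbsIntegers v := fun n ↦
    ⟨z n, (mem_localAbsIntegers_iff_spectralValuation hw).mpr (hz1 n)⟩
  have hb : ∀ (n : ℕ) (σ : G), ((σ • b n : localAbsIntegers v) : AlgebraicClosure (v.adicCompletion K)) =
      σ • z n := fun n σ ↦ integralClosure.coe_smul _ _
  -- the closed sets `S n = {ι ∈ I | ι ζ_n = F₀ ζ_n}`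
  let S : ℕ → Set G := fun n ↦ (I : Set G) ∩ {σ | σ • b n = F₀ • b n}
  have hSmem : ∀ n σ, σ ∈ S n ↔ σ ∈ I ∧ σ • z n = F₀ • z n := fun n σ ↦ by
    change σ ∈ (I : Set G) ∧ σ • b n = F₀ • b n ↔ _
    rw [SetLike.mem_coe, Subtype.ext_iff, hb, hb]
  have hIclosed : IsClosed (I : Set G) := by
    have e : (I : Set G) = ⋂ x : localAbsIntegers v, {g : G | g • x - x ∈ 𝔐} := by
      ext g
      simp only [Set.mem_iInter, SetLike.mem_coe, Set.mem_setOf_eq]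
      rfl
    rw [e]
    exact isClosed_iInter fun x ↦ isClosed_setOf_smul_sub_mem_local v 𝔐 x
  have hclosed : ∀ n, IsClosed (S n) := fun n ↦ by
    refine hIclosed.inter ?_
    letI : TopologicalSpace (localAbsIntegers v) := ⊥
    haveI : DiscreteTopology (localAbsIntegers v) := ⟨rfl⟩
    haveI := absIntegers.continuousSMul (v.adicCompletionIntegers K) (K := v.adicCompletion K)
    have hc : Continuous fun g : G ↦ g • b n := continuous_id.smul continuous_const
    exact (isClosed_discrete {y : localAbsIntegers v | y = F₀ • b n}).preimage hc
  have hanti : ∀ n, S (n + 1) ⊆ S n := fun n σ hσ ↦ by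
    rw [hSmem] at hσ ⊢
    refine ⟨hσ.1, ?_⟩
    rw [← hzp n, smul_pow', smul_pow', hσ.2]
  have hne : ∀ n, (S n).Nonempty := fun n ↦ by
    obtain ⟨ι, hι, hιz⟩ := exists_mem_inertia_smul_eq_of_isPrimitiveRoot hw h𝔐 hpv hϖ n (hz n)
      (isPrimitiveRoot_smul (hz n) F₀)
    exact ⟨ι, (hSmem n ι).mpr ⟨hι, hιz⟩⟩
  obtain ⟨ι, hι⟩ := IsCompact.nonempty_iInter_of_sequence_nonempty_isCompact_isClosed S hanti hne
    (hclosed 0).isCompact hclosed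
  have hιI : ι ∈ I := ((hSmem 0 ι).mp (Set.mem_iInter.mp hι 0)).1
  have hιz : ∀ n, ι • z n = F₀ • z n := fun n ↦ ((hSmem n ι).mp (Set.mem_iInter.mp hι n)).2
  -- `τ = ι⁻¹ F₀`
  refine ⟨ι⁻¹ * F₀, fun x ↦ ?_, fun k ξ hξ ↦ ?_⟩
  · have h1 := hF₀ x
    have h2 : ι⁻¹ • (F₀ • x) - F₀ • x ∈ 𝔐 := (I.inv_mem hιI) (F₀ • x)
    have e : (ι⁻¹ * F₀) • x - x ^ Nat.card (v.adicCompletionIntegers K ⧸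
        Ideal.under (v.adicCompletionIntegers K) 𝔐) =
        (ι⁻¹ • (F₀ • x) - F₀ • x) + (F₀ • x - x ^ Nat.card (v.adicCompletionIntegers K ⧸
          Ideal.under (v.adicCompletionIntegers K) 𝔐)) := by
      rw [mul_smul]; abel
    change (ι⁻¹ * F₀) • x - x ^ Nat.card (v.adicCompletionIntegers K ⧸
        Ideal.under (v.adicCompletionIntegers K) 𝔐) ∈ 𝔐
    rw [e]
    exact add_mem h2 h1
  · have hτz : ∀ n, (ι⁻¹ * F₀) • z n = z n := fun n ↦ by
      rw [mul_smul, ← hιz n, inv_smul_smul]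
    cases k with
    | zero =>
      rw [pow_zero, pow_one] at hξ
      rw [hξ, smul_one]
    | succ k =>
      obtain ⟨i, -, rfl⟩ := (hz k).eq_pow_of_pow_eq_one hξ
      rw [smul_pow', hτz k]

include hw h𝔐 hpv hϖ in
/-- **For the cyclotomic `ℤ_p`-extension the local subgroup `H_{v,∞}` contains a Frobenius**
(`ℚ_∞/ℚ` — more generally `K_∞^{cyc}/K` at a place `v ∣ p` unramified over `p` — is totally
ramified at `v`, so the residue field of `K_{∞,η}` is `k_v`): there is an arithmetic Frobenius
`τ ∈ Γ_{K_v}` at `𝔐` whose restriction `resGal τ ∈ Γ_K` lies in `ker κ = χ_p⁻¹(μ(ℤ_p))`, indeed has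
`χ_p(resGal τ) = 1` (`τ` fixes `μ_{p^∞}(K̄_v) ⊇ closureEmb(μ_{p^∞}(K̄))`). Washington, *Introduction
to Cyclotomic Fields*, §13.1; Greenberg, LNM 1716, §3 p. 89 ("`v_n` is totally ramified in
`F_∞/F_n`"). [cite: Washington1997, §13.1] [cite: GreenbergLNM1716, §3 Lemma 3.4 (p. 89)] -/
theorem _root_.Literature.NumberTheory.EllipticCurves.ZpExtension.IsCyclotomic.exists_isArithFrobAt_resGal_mem_kerSubgroup
    {κ : ZpExtension K p} (hκ : κ.IsCyclotomic) :
    ∃ τ : absoluteGaloisGroup (v.adicCompletion K),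
      IsArithFrobAt (v.adicCompletionIntegers K) τ 𝔐 ∧
        resGal (K := K) (v.adicCompletion K) τ ∈ κ.kerSubgroup := by
  have hpp := hp.out
  obtain ⟨τ, hτF, hτfix⟩ := exists_isArithFrobAt_forall_smul_eq hw h𝔐 hpv hϖ
  refine ⟨τ, hτF, ?_⟩
  set σ : absoluteGaloisGroup K := resGal (K := K) (v.adicCompletion K) τ with hσdef
  -- `σ` fixes the `p`-power roots of unity of `K̄`
  have hfix : ∀ (k : ℕ) (t : AlgebraicClosure K), t ^ p ^ k = 1 → σ • t = t := by
    intro k t ht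
    apply (closureEmb (K := K) (v.adicCompletion K)).toRingHom.injective
    have h1 : closureEmb (K := K) (v.adicCompletion K) (σ • t) =
        τ • closureEmb (K := K) (v.adicCompletion K) t :=
      AlgHom.congr_fun (closureEmb_comp_resGalAux (K := K) (v.adicCompletion K) τ) t
    change closureEmb (K := K) (v.adicCompletion K) (σ • t) = closureEmb (K := K) (v.adicCompletion K) t
    rw [h1]
    exact hτfix k _ (by rw [← map_pow, ht, map_one])
  -- hence `χ_p(σ) = 1`
  have hχ : GaloisRep.cyclotomicCharacter K p σ = 1 := by
    haveI : NeZero (p : K) := ⟨Nat.cast_ne_zero.mpr hpp.ne_zero⟩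
    refine Units.ext (PadicInt.ext_of_toZModPow.mp fun k ↦ ?_)
    rw [Units.val_one, map_one]
    cases k with
    | zero =>
      haveI : Subsingleton (ZMod (p ^ 0)) := by rw [pow_zero]; infer_instance
      exact Subsingleton.elim _ _
    | succ k =>
      haveI : NeZero ((p ^ (k + 1) : ℕ) : AlgebraicClosure K) :=
        ⟨by exact_mod_cast pow_ne_zero (k + 1) hpp.ne_zero⟩
      obtain ⟨t, ht⟩ := HasEnoughRootsOfUnity.exists_primitiveRoot (AlgebraicClosure K) (p ^ (k + 1))
      have hspec := GaloisRep.cyclotomicCharacter_spec K p (k := k + 1) σ t ht.pow_eq_one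
      rw [hfix (k + 1) t ht.pow_eq_one] at hspec
      have hlt : 1 < p ^ (k + 1) := Nat.one_lt_pow (by omega) hpp.one_lt
      haveI : Fact (1 < p ^ (k + 1)) := ⟨hlt⟩
      have hc := ht.pow_inj (ZMod.val_lt _) hlt (hspec.symm.trans (pow_one t).symm)
      exact ZMod.val_injective _ (hc.trans (ZMod.val_one _).symm)
  rw [show κ.kerSubgroup = _ from hκ, Subgroup.mem_comap, CommGroup.mem_torsion]
  change IsOfFinOrder (GaloisRep.cyclotomicCharacter K p σ)
  rw [hχ]
  exact IsOfFinOrder.one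

end IsDedekindDomain.HeightOneSpectrum
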